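import Summits.ABC.IUTFork.Conditional.AbcOfSGenuineKChosenDepthRad
import Summits.ABC.IUTFork.Cor312ProvKChosenQIdeleNorm
import Literature.IUT.LogVolume.LogRadiusClosedForm
import Literature.IUT.LogVolume.DifferentEstimatesCorollaries
import HarnessLib

/-!
# Branch C / R-W lane P−: the EXACT-RADIUS («RAD») refutation at RATIONAL points — a pole of `j(λ)` of order `h` at `p`, ONE place
# `x₀ | p` of local type `e`, and TWO INTEGER INEQUALITIES decide the window binder's per-datum instance (kind-RAD rows of TARGETS.tsv)

PROOF-ONLY file (no `def`, no new `Prop`, no instance) of the abc-iut cell (WAVE-5 prover seat abc-iut-w5-d236, gen 9; D-0079 R-W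
«WINDOW Θ-SIDE INEQUALITY», CLAIM «W:RAD-GENUINEK lane=P−»; sequel of this seat's `AbcOfSGenuineKChosenDepthRad` p463434). TAKES NO SIDE
on [IUTchIII] Cor. 3.12 or on any author. One `obtain` each on: abc-iut-w4-d026's `Cor312Prov.norm_chosenQIdele_le_rpow_of_ratPoint'` /
`norm_chosenQIdele_eq_rpow_ord_rat'` (p442760/p443027: at a rational point EVERY place `x₀ | p` over an odd pole prime `p ≠ l` of `j(λ)` is
BAD, and the CHOSEN realising q-idele has `‖t_q(x₀)‖ = p^{ord_p j(λ)/(2l)}` EXACTLY — the ramification cancels), abc-iut-w5-d009's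
`exists_nat_qPilot_pilotDataOfK` (integral q-degree `P`), this seat's `GenuineK.not_pilotKummerCompatHull_chosen_of_star_envelope`
(the genuine-`K` form of abc-iut-c312-3's star × envelope socket), and the closed forms `logRadiusA_eq_of_window` (`a = A/e` on the window
`(A−1)(p−2) < e ≤ A(p−2)`) / `differentOrd_eq_of_not_dvd` (`d = (e−1)/e` off `p ∣ e`).

* §1 `RadRow.real_test_of_certificate` — arithmetic: with `P/e = h/(2l)`, `e·d ≤ δ`, `a = A/e`, the two INTEGER inequalities
  **`2l·e·N ≤ (i₀+1)²·h·e − 2l·((i₀+1)·δ + (i₀+2)·A)`** (an integer `N` below the absorption exponent) and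
  **`h·e < 2l·(e·N + (i₀+2)·(p^{a₀} − e·a₀))`** (the q-centre escapes the envelope polydisc) give the real RAD test of p463434;
  `RadRow.turning_of_bounds` — the turning point from its two boundary checks.
* §2 `GenuineK.not_pilotKummerCompatHull_chosen_ratPoint_of_star_envelope` — `T : Cor22.ThetaVolumeDatumAt (ratPoint λ) l`, an odd prime
  `p ≠ l` with `ord_p j(λ) = −h` EXACTLY (`h ≥ 1`), a label `j = i₀+1 ≤ l⋆`, natural parameters `(e, δ, A, a₀)` and an integer `N` passing
  the window checks and the two inequalities ⇒ at EVERY place `x₀ | p` of `T.K` of local type `e(K_{x₀}/ℚ_p) = e` with `e·d(K_{x₀}) ≤ δ`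
  (both BINDERS — the LOCAL-TYPE inputs of the R-W table, discharged per datum by abc-iut-W-neg-1's lemmas / the N2 differents) the
  hull-level clause S_H at the genuine sharp setting over `T.K` (CHOSEN realising ideles, PINNED reading, every choice of the free context
  binders and Kummer datum — verbatim the per-datum object of `hSHw`/`hSHwBad`) FAILS;
* §3 `…_of_not_dvd` — the different binder DISCHARGED off `p ∣ e` (`δ = e − 1`, classical tame different): the only local input left is
  the local type `e` itself — the shape of every kind-RAD Frey row at `p ≥ 7` and of the critical-path Reyssat packet `(λ = 2/23⁵, l = 13, p = 23)`.

HONEST SCOPE as in the parent files: an UPPER BOUND on the hull read at ONE diagonal summand; SHARP reading; per-label licence STRONGER than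
print; nothing about the printed GLOBAL inequality, the NUMBER-level Corollary or any author's intended hull; admissibility / (P6) of
`(ratPoint λ, l)` and non-emptiness of the datum type are NOT claimed here (apex assembler's inputs); «refuted as typed» ≠ «refuted in print»;
typed ≠ proved; instantiated ≠ endorsed. [cite: Mochizuki2012, IUTchIII Cor. 3.12 Step (xi-f) p. 184; IUTchIV Prop. 1.1 p. 9, Prop. 1.2 (i)(ii)
p. 10, Cor. 2.2 (ii) proof (P5) p. 46; IUTchI Ex. 3.2 (iv) p. 71] [cite: DupuyHilado2025, §3.3, §3.4, §4.9, §4.12] [cite: NeukirchANT1999, Ch. II (5.5)]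
[cite: SerreLocalFields1979, Ch. III §6 Prop. 13] [cite: ScholzeStix2018, §2.2 pp. 9–10] [claim: Mochizuki2012, status: disputed] for every IUT sentence quoted.
-/

noncomputable section

open Set Function NumberField IsDedekindDomain

namespace Summit.ABC.IUTFork.Conditional

open Thm311 Thm311.Real Cor312 Cor312Vol Cor312Prov Literature.IUT.LogThetaLattice Literature.IUT.LogVolume
  Literature.IUT.HodgeTheaters Literature.IUT.LogVolume.ThetaData Literature.IUT.LogVolume.Cor22
  Literature.IUT.LogVolume.LogEnvelope
open Literature.NumberTheory.NumberFields Literature.NumberTheory.GaloisRepresentations.Ultrametric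
open Literature.NumberTheory.DiophantineGeometry.GenEll Summit.ABC.ABC.Theorems

/-! ## §1. Arithmetic: the real RAD test from two integer inequalities -/

namespace RadRow

/-- **The RAD test from an INTEGER CERTIFICATE.** With `P/e = h/(2l)` (realising q-idele over a pole of order `h`), `e·d ≤ δ`
(different), `a = A/e` ([IUTchIV] Prop. 1.2 exponent) and an integer `N` with `2l·e·N ≤ (i₀+1)²·h·e − 2l·((i₀+1)·δ + (i₀+2)·A)` and
`h·e < 2l·(e·N + (i₀+2)·(p^{a₀} − e·a₀))`:  `P/e < ⌊(i₀+1)²·P/e − (i₀+1)·d − (i₀+2)·a⌋ + (i₀+2)·(p^{a₀} − e·a₀)/e`. [folklore] -/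
theorem real_test_of_certificate {p e h l i₀ δ A a₀ P : ℕ} {N : ℤ} {d a : ℝ} (he : 1 ≤ e) (hl : 1 ≤ l)
    (hPe : (((P : ℤ) : ℝ)) / (e : ℝ) = (h : ℝ) / (2 * l))
    (hd : (e : ℝ) * d ≤ δ) (ha : a = (A : ℝ) / e)
    (hN1 : 2 * (l : ℤ) * e * N ≤ ((i₀ : ℤ) + 1) ^ 2 * h * e - 2 * l * (((i₀ : ℤ) + 1) * δ + ((i₀ : ℤ) + 2) * A))
    (hN2 : (h : ℤ) * e < 2 * l * ((e : ℤ) * N + ((i₀ : ℤ) + 2) * ((p : ℤ) ^ a₀ - e * a₀))) :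
    (((P : ℤ) : ℝ)) / (e : ℝ) <
      ⌊(((((i₀ + 1) ^ 2 * P : ℕ) : ℤ) : ℝ)) / (e : ℝ) - (((i₀ : ℕ) : ℝ) + 1) * d - (((i₀ : ℕ) : ℝ) + 2) * a⌋
        + (((i₀ : ℕ) : ℝ) + 2) * (((((p : ℤ) ^ a₀ - (e : ℤ) * (a₀ : ℤ) : ℤ)) : ℝ) / (e : ℝ)) := by
  have he0 : (0 : ℝ) < (e : ℝ) := by exact_mod_cast he
  have hl0 : (0 : ℝ) < (l : ℝ) := by exact_mod_cast hl
  have h2le : (0 : ℝ) < 2 * (l : ℝ) * e := by positivity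
  -- the three pieces of the floor argument
  have hP' : (((((i₀ + 1) ^ 2 * P : ℕ) : ℤ) : ℝ)) / (e : ℝ) = (((i₀ : ℕ) : ℝ) + 1) ^ 2 * ((h : ℝ) / (2 * l)) := by
    rw [← hPe]
    push_cast
    ring
  have hd' : (((i₀ : ℕ) : ℝ) + 1) * d ≤ (((i₀ : ℕ) : ℝ) + 1) * ((δ : ℝ) / e) := by
    refine mul_le_mul_of_nonneg_left ?_ (by positivity)
    rw [le_div_iff₀ he0, mul_comm]
    exact hd
  -- `N` lies below the floor argument
  have hN1' : (2 * (l : ℤ) * e * N : ℝ) ≤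
      (((i₀ : ℤ) + 1) ^ 2 * h * e - 2 * l * (((i₀ : ℤ) + 1) * δ + ((i₀ : ℤ) + 2) * A) : ℝ) := by
    exact_mod_cast hN1
  have hNx : (N : ℝ) ≤ (((i₀ : ℕ) : ℝ) + 1) ^ 2 * ((h : ℝ) / (2 * l)) - (((i₀ : ℕ) : ℝ) + 1) * ((δ : ℝ) / e)
      - (((i₀ : ℕ) : ℝ) + 2) * ((A : ℝ) / e) := by
    have hrw : (((i₀ : ℕ) : ℝ) + 1) ^ 2 * ((h : ℝ) / (2 * l)) - (((i₀ : ℕ) : ℝ) + 1) * ((δ : ℝ) / e)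
        - (((i₀ : ℕ) : ℝ) + 2) * ((A : ℝ) / e) =
        ((((i₀ : ℕ) : ℝ) + 1) ^ 2 * h * e - 2 * l * ((((i₀ : ℕ) : ℝ) + 1) * δ + (((i₀ : ℕ) : ℝ) + 2) * A)) / (2 * l * e) := by
      field_simp
      ring
    rw [hrw, le_div_iff₀ h2le]
    push_cast at hN1' ⊢
    linarith
  have hfloor : (N : ℝ) ≤
      (⌊(((((i₀ + 1) ^ 2 * P : ℕ) : ℤ) : ℝ)) / (e : ℝ) - (((i₀ : ℕ) : ℝ) + 1) * d - (((i₀ : ℕ) : ℝ) + 2) * a⌋ : ℝ) := by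
    have h1 : (N : ℝ) ≤ (((((i₀ + 1) ^ 2 * P : ℕ) : ℤ) : ℝ)) / (e : ℝ) - (((i₀ : ℕ) : ℝ) + 1) * d - (((i₀ : ℕ) : ℝ) + 2) * a := by
      rw [hP', ha]
      linarith
    exact_mod_cast Int.le_floor.mpr h1
  -- the q-centre escapes the envelope polydisc
  have hN2' : ((h : ℤ) * e : ℝ) < (2 * l * ((e : ℤ) * N + ((i₀ : ℤ) + 2) * ((p : ℤ) ^ a₀ - e * a₀)) : ℝ) := by
    exact_mod_cast hN2
  have hq : (h : ℝ) / (2 * l) < (N : ℝ) + (((i₀ : ℕ) : ℝ) + 2) * (((((p : ℤ) ^ a₀ - (e : ℤ) * (a₀ : ℤ) : ℤ)) : ℝ) / (e : ℝ)) := by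
    have hrw : (N : ℝ) + (((i₀ : ℕ) : ℝ) + 2) * (((((p : ℤ) ^ a₀ - (e : ℤ) * (a₀ : ℤ) : ℤ)) : ℝ) / (e : ℝ)) =
        (2 * l * ((e : ℝ) * N + (((i₀ : ℕ) : ℝ) + 2) * (((((p : ℤ) ^ a₀ - (e : ℤ) * (a₀ : ℤ) : ℤ)) : ℝ)))) / (2 * l * e) := by
      field_simp
    rw [hrw, div_lt_div_iff₀ (by positivity) h2le]
    push_cast at hN2' ⊢
    nlinarith [hN2', hl0, he0]
  rw [hPe]
  linarith

/-- **Turning point from two boundary checks**: `a₀ = 0 ∨ p^{a₀−1}·(p−1) < e` and `e ≤ p^{a₀}·(p−1)` give the turning-point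
hypotheses of the envelope sockets (the increments `p^a·(p−1)` grow; abc-iut-c312-3 `LogEnvelope.forall_lt_of_pred_lt`).
[cite: NeukirchANT1999, Ch. II (5.5)] -/
theorem turning_of_bounds {p : ℕ} [Fact p.Prime] {e a₀ : ℕ} (hlo : a₀ = 0 ∨ (p : ℤ) ^ (a₀ - 1) * ((p : ℤ) - 1) < e) :
    ∀ a < a₀, (p : ℤ) ^ a * ((p : ℤ) - 1) < e := by
  rcases hlo with h0 | hlt
  · subst h0; intro a ha; exact absurd ha (Nat.not_lt_zero a)
  · refine forall_lt_of_pred_lt (p := p) fun a ha => ?_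
    have : a = a₀ - 1 := by omega
    subst this
    exact hlt

end RadRow

/-! ## §2. The RAD refutation at a rational point, local type and different as binders -/

/-- **EXACT-RADIUS (RAD) REFUTATION AT A RATIONAL POINT.** `λ ∈ ℚ`, `T` a genuine Θ-volume datum at `(ratPoint λ, l)`; an odd prime
`p ≠ l` at which `j(λ)` has a pole of order EXACTLY `h ≥ 1`; a label `j = i₀ + 1 ≤ l⋆ = (l−1)/2`; natural parameters `e ≥ 1` (local type),
`δ` (different bound in `ϖ`-units), `A` with `(A−1)(p−2) < e ≤ A(p−2)` (`a(p,e) = A/e`), `a₀` with `a₀ = 0 ∨ p^{a₀−1}(p−1) < e` and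
`e ≤ p^{a₀}(p−1)` (turning point), and an integer `N` with
**`2l·e·N ≤ (i₀+1)²·h·e − 2l·((i₀+1)·δ + (i₀+2)·A)`** and **`h·e < 2l·(e·N + (i₀+2)·(p^{a₀} − e·a₀))`**. THEN at EVERY place `x₀ | p`
of `T.K` with `e(K_{x₀}/ℚ_p) = e` and `e·d(K_{x₀}) ≤ δ` (the LOCAL-TYPE inputs, binders) the hull-level clause S_H at the genuine sharp
setting over `T.K` (CHOSEN realising ideles, PINNED reading) FAILS for every choice of the free context binders and Kummer datum: `x₀` is bad
with `‖t_q(x₀)‖ = p^{−h/(2l)} = p^{−P/e}` (abc-iut-w4-d026; `P = P_q(x₀) ∈ ℕ`, abc-iut-w5-d009), and the RAD test of p463434 holds by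
`RadRow.real_test_of_certificate`. Sharp reading; refuted-as-typed only. [cite: Mochizuki2012, IUTchIV Cor. 2.2 (ii) proof (P5) p. 46,
Prop. 1.2 (i)(ii) p. 10; IUTchIII Cor. 3.12 Step (xi-f) p. 184] [cite: NeukirchANT1999, Ch. II (5.5)] [claim: Mochizuki2012, status: disputed] -/
theorem GenuineK.not_pilotKummerCompatHull_chosen_ratPoint_of_star_envelope {q : ℚ} {l : ℕ}
    (T : Cor22.ThetaVolumeDatumAt (ratPoint q) l) (pp : Nat.Primes) (hp2 : (pp : ℕ) ≠ 2) (hpl : (pp : ℕ) ≠ l)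
    (h : ℕ) (hh : 1 ≤ h)
    (hord : ∀ u : HeightOneSpectrum (𝓞 ℚ), Rat.HeightOneSpectrum.natGenerator u = (pp : ℕ) → ord ℚ u (Cor22.jInv q) = -(h : ℤ))
    (i₀ : ℕ) (hil : i₀ + 1 ≤ (l - 1) / 2)
    (e δ A a₀ : ℕ) (N : ℤ) (he : 1 ≤ e)
    (hAlo : (A - 1) * ((pp : ℕ) - 2) < e) (hAhi : e ≤ A * ((pp : ℕ) - 2))
    (ha₀lo : a₀ = 0 ∨ ((pp : ℕ) : ℤ) ^ (a₀ - 1) * (((pp : ℕ) : ℤ) - 1) < e)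
    (ha₀hi : (e : ℤ) ≤ ((pp : ℕ) : ℤ) ^ a₀ * (((pp : ℕ) : ℤ) - 1))
    (hN1 : 2 * (l : ℤ) * e * N ≤ ((i₀ : ℤ) + 1) ^ 2 * h * e - 2 * l * (((i₀ : ℤ) + 1) * δ + ((i₀ : ℤ) + 2) * A))
    (hN2 : (h : ℤ) * e < 2 * l * ((e : ℤ) * N + ((i₀ : ℤ) + 2) * (((pp : ℕ) : ℤ) ^ a₀ - e * a₀))) :
    letI := T.instFieldF; letI := T.instNumberFieldF; letI := T.instAlgebraF; letI := T.instFieldK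
    letI := T.instNumberFieldK; letI := T.instAlgebraK; letI := T.instFieldFbar; letI := T.instAlgebraFbar
    letI := T.instAlgebraKFbar; letI := T.instIsElliptic
    haveI : Fact (pp : ℕ).Prime := ⟨pp.2⟩
    ∀ (x₀ : (thetaIndex (pilotDataOfK T.D T.K)).Fibre (.inr pp)),
      absRamificationIdx (pp : ℕ) (kOf (pilotDataOfK T.D T.K) pp.1 x₀) = e →
      (e : ℝ) * differentOrd (pp : ℕ) (kOf (pilotDataOfK T.D T.K) pp.1 x₀) ≤ δ →
    ∀ (M : Type) [Field M] [NumberField M]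
      (archPk : ∀ (j : (thetaIndex (pilotDataOfK T.D T.K)).Label) (vQ : (thetaIndex (pilotDataOfK T.D T.K)).VQ),
        Set ((logShellsDH (pilotDataOfK T.D T.K) (analyticLogv T.K)).Packet j vQ))
      (archSub : ∀ (j : (thetaIndex (pilotDataOfK T.D T.K)).Label) (v : (thetaIndex (pilotDataOfK T.D T.K)).V),
        Set ((logShellsDH (pilotDataOfK T.D T.K) (analyticLogv T.K)).Packet j ((thetaIndex (pilotDataOfK T.D T.K)).over v)))
      (Ψ : ℤ → ∀ v : (thetaIndex (pilotDataOfK T.D T.K)).V, v ∈ (thetaIndex (pilotDataOfK T.D T.K)).Vbad →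
        Set ((logShellsDH (pilotDataOfK T.D T.K) (analyticLogv T.K)).StarPacket v))
      (act : ℤ → ∀ v : (thetaIndex (pilotDataOfK T.D T.K)).V, v ∈ (thetaIndex (pilotDataOfK T.D T.K)).Vbad →
        (logShellsDH (pilotDataOfK T.D T.K) (analyticLogv T.K)).StarPacket v →
          Module.End ℚ ((logShellsDH (pilotDataOfK T.D T.K) (analyticLogv T.K)).StarPacket v))
      (Mmod : ℤ → ∀ j : (thetaIndex (pilotDataOfK T.D T.K)).LabelStar, Set ((logShellsDH (pilotDataOfK T.D T.K) (analyticLogv T.K)).GlobalPacket j.1))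
      (region : ℤ → ∀ j : (thetaIndex (pilotDataOfK T.D T.K)).LabelStar, FinDivisor M → ∀ vQ : (thetaIndex (pilotDataOfK T.D T.K)).VQ,
        Set ((logShellsDH (pilotDataOfK T.D T.K) (analyticLogv T.K)).Packet j.1 vQ))
      (frobAdm : ℤ → ℤ → ∀ (j : (thetaIndex (pilotDataOfK T.D T.K)).Label) (vQ : (thetaIndex (pilotDataOfK T.D T.K)).VQ),
        Set ((logShellsDH (pilotDataOfK T.D T.K) (analyticLogv T.K)).Packet j vQ) → Prop)
      (frobLogvol : ℤ → ℤ → ∀ (j : (thetaIndex (pilotDataOfK T.D T.K)).Label) (vQ : (thetaIndex (pilotDataOfK T.D T.K)).VQ),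
        Set ((logShellsDH (pilotDataOfK T.D T.K) (analyticLogv T.K)).Packet j vQ) → ℝ)
      (frobΨ : ℤ → ℤ → ∀ v : (thetaIndex (pilotDataOfK T.D T.K)).V, v ∈ (thetaIndex (pilotDataOfK T.D T.K)).Vbad →
        Set ((logShellsDH (pilotDataOfK T.D T.K) (analyticLogv T.K)).StarPacket v))
      (frobMmod : ℤ → ℤ → ∀ j : (thetaIndex (pilotDataOfK T.D T.K)).LabelStar, Set ((logShellsDH (pilotDataOfK T.D T.K) (analyticLogv T.K)).GlobalPacket j.1))
      (unitImage : ℤ → ℤ → ℕ → ∀ (j : (thetaIndex (pilotDataOfK T.D T.K)).Label) (vQ : (thetaIndex (pilotDataOfK T.D T.K)).VQ),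
        Set ((logShellsDH (pilotDataOfK T.D T.K) (analyticLogv T.K)).Packet j vQ))
      (ballImage : ℤ → ℤ → ∀ (j : (thetaIndex (pilotDataOfK T.D T.K)).Label) (vQ : (thetaIndex (pilotDataOfK T.D T.K)).VQ),
        Set ((logShellsDH (pilotDataOfK T.D T.K) (analyticLogv T.K)).Packet j vQ))
      (thetaDiv : ℤ → ℤ → LgpDivisor M (thetaIndex (pilotDataOfK T.D T.K)).lstar)
      (n : ℤ) {HT : Type} {LogLink : HT → HT → Type} {IsFull : ∀ {s t : HT}, LogLink s t → Prop}
      (lat : LGPGaussianLogThetaLattice LogLink IsFull)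
      {Frd : Type} {IsoF : Frd → Frd → Type} {Ob : Frd → Type} {realify : Frd → Frd} {Strip : Type}
      {IsoS : Strip → Strip → Type} {Mv : ∀ v : (thetaIndex (pilotDataOfK T.D T.K)).V, v ∈ (thetaIndex (pilotDataOfK T.D T.K)).Vbad → Type}
      [∀ v h, Monoid (Mv v h)]
      (sig : GlobalLGPFrobenioidSignature (thetaIndex (pilotDataOfK T.D T.K)).lstar (thetaIndex (pilotDataOfK T.D T.K)).V
        (· ∈ (thetaIndex (pilotDataOfK T.D T.K)).Vbad) Frd IsoF Ob realify Strip IsoS Mv)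
      (split : SplittingMonoids Mv) {ObΔ : Type} {N' : ∀ v : (thetaIndex (pilotDataOfK T.D T.K)).V, v ∈ (thetaIndex (pilotDataOfK T.D T.K)).Vbad → Type}
      [∀ v h, Monoid (N' v h)] (qData : QPilotData ObΔ N')
      (qK : ∀ v : (thetaIndex (pilotDataOfK T.D T.K)).V, v ∈ (thetaIndex (pilotDataOfK T.D T.K)).Vbad →
        Set ((logShellsDH (pilotDataOfK T.D T.K) (analyticLogv T.K)).StarPacket v)),
      ¬ Cor312Vol.PilotKummerCompatHull
          (LatticeSituation.ofShells (logShellsDH (pilotDataOfK T.D T.K) (analyticLogv T.K)) M archPk archSub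
            (summandPiecesPr (pilotDataOfK T.D T.K) (logvAnalytic_analyticLogv (F := T.K))).Adm
            (summandPiecesPr (pilotDataOfK T.D T.K) (logvAnalytic_analyticLogv (F := T.K))).logvol Ψ act Mmod region frobAdm frobLogvol frobΨ
            frobMmod unitImage ballImage thetaDiv)
          (settingPrVolSharp (pilotDataOfK T.D T.K) (logvAnalytic_analyticLogv (F := T.K)) M archPk archSub Ψ act Mmod region n lat sig split qData
            (exists_realising_qIdeles_pilotDataOfK T.D).choose (exists_realising_thetaIdeles_pilotDataOfK T.D).choose
            (exists_realising_qIdeles_pilotDataOfK T.D).choose_spec.1 (exists_realising_qIdeles_pilotDataOfK T.D).choose_spec.2.1)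
          (fun _ => Cor312.Setting.qRegion
            (settingPrVolSharp (pilotDataOfK T.D T.K) (logvAnalytic_analyticLogv (F := T.K)) M archPk archSub Ψ act Mmod region n lat sig split qData
              (exists_realising_qIdeles_pilotDataOfK T.D).choose (exists_realising_thetaIdeles_pilotDataOfK T.D).choose
              (exists_realising_qIdeles_pilotDataOfK T.D).choose_spec.1 (exists_realising_qIdeles_pilotDataOfK T.D).choose_spec.2.1)) qK := by
  classical
  letI := T.instFieldF; letI := T.instNumberFieldF; letI := T.instAlgebraF; letI := T.instFieldK
  letI := T.instNumberFieldK; letI := T.instAlgebraK; letI := T.instFieldFbar; letI := T.instAlgebraFbar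
  letI := T.instAlgebraKFbar; letI := T.instIsElliptic
  haveI : Fact (pp : ℕ).Prime := ⟨pp.2⟩
  intro x₀ hex hδ M _ _ archPk archSub Ψ act Mmod region frobAdm frobLogvol frobΨ frobMmod unitImage ballImage thetaDiv n HT LogLink IsFull lat
    Frd IsoF Ob realify Strip IsoS Mv _ sig split ObΔ N' _ qData qK
  -- the label `j = i₀ + 1 ≤ l⋆` as an index
  have hlstar : (thetaIndex (pilotDataOfK T.D T.K)).lstar = (l - 1) / 2 := by
    show ((pilotDataOfK T.D T.K).l - 1) / 2 = (l - 1) / 2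
    rw [pilotDataOfK_l]
  have hlt : i₀ < (thetaIndex (pilotDataOfK T.D T.K)).lstar := by rw [hlstar]; omega
  have hl5 : 5 ≤ l := T.D.five_le_l
  have hp2' : 2 < (pp : ℕ) := by
    have := pp.2.two_le
    omega
  have hp1 : (1 : ℝ) < ((pp : ℕ) : ℝ) := by exact_mod_cast pp.2.one_lt
  -- `x₀` is bad (abc-iut-w4-d026); the integral q-degree `P` (abc-iut-w5-d009)
  obtain ⟨hS, -⟩ := norm_chosenQIdele_le_rpow_of_ratPoint' T.D q T.j_eq T.isP5Choice pp x₀ hp2 hpl h hh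
    (fun u hu => (hord u hu).le)
  obtain ⟨P, hP, -, -⟩ := exists_nat_qPilot_pilotDataOfK T.D hS
  -- the CHOSEN q-idele's norm read two ways: `p^{−h/(2l)}` (rational `j`, ramification cancels) and `p^{−P/e}` (realising)
  have hjF : T.E.j = (((Cor22.jInv q : ℚ)) : T.F) := by rw [T.j_eq]; exact eq_ratCast _ _
  have hn1 := norm_chosenQIdele_eq_rpow_ord_rat' T.D pp x₀ hS (Cor22.jInv q) hjF
  rw [hord _ (natGenerator_finBelow_placeOf T.D pp x₀)] at hn1
  have hn2 := norm_qIdele_eq_rpow_intCast_of_realises (pilotDataOfK T.D T.K) (exists_realising_qIdeles_pilotDataOfK T.D).choose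
    (exists_realising_qIdeles_pilotDataOfK T.D).choose_spec.1 (exists_realising_qIdeles_pilotDataOfK T.D).choose_spec.2.2 pp x₀ P hP
  rw [hex] at hn2
  have hPe : (((P : ℤ) : ℝ)) / (e : ℝ) = (h : ℝ) / (2 * l) := by
    have hE : ((pp : ℕ) : ℝ) ^ (-(((P : ℤ) : ℝ) / (e : ℝ))) = ((pp : ℕ) : ℝ) ^ ((((-(h : ℤ) : ℤ)) : ℝ) / (2 * l)) := by
      rw [← hn2, ← hn1]
    have h1 : -(((P : ℤ) : ℝ) / (e : ℝ)) ≤ (((-(h : ℤ) : ℤ)) : ℝ) / (2 * l) := (Real.rpow_le_rpow_left_iff hp1).mp hE.le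
    have h2 : (((-(h : ℤ) : ℤ)) : ℝ) / (2 * l) ≤ -(((P : ℤ) : ℝ) / (e : ℝ)) := (Real.rpow_le_rpow_left_iff hp1).mp hE.ge
    have h3 : -(((P : ℤ) : ℝ) / (e : ℝ)) = (((-(h : ℤ) : ℤ)) : ℝ) / (2 * l) := le_antisymm h1 h2
    push_cast at h3
    rw [neg_div, neg_inj] at h3
    push_cast
    exact h3
  -- the closed forms of the [IUTchIV] Prop. 1.2 exponent and the turning point at `e`
  have ha : logRadiusA (pp : ℕ) e = (A : ℝ) / e := logRadiusA_eq_of_window hp2' he hAlo hAhi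
  have hlo : ∀ a < a₀, ((pp : ℕ) : ℤ) ^ a * (((pp : ℕ) : ℤ) - 1) < absRamificationIdx (pp : ℕ) (kOf (pilotDataOfK T.D T.K) pp.1 x₀) := by
    rw [hex]
    exact RadRow.turning_of_bounds ha₀lo
  have hhi : (absRamificationIdx (pp : ℕ) (kOf (pilotDataOfK T.D T.K) pp.1 x₀) : ℤ) ≤ ((pp : ℕ) : ℤ) ^ a₀ * (((pp : ℕ) : ℤ) - 1) := by
    rw [hex]
    exact ha₀hi
  -- the real RAD test of the parent file
  have htest := RadRow.real_test_of_certificate (p := (pp : ℕ)) (i₀ := i₀) (a₀ := a₀) he (by omega) hPe hδ ha hN1 hN2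
  refine GenuineK.not_pilotKummerCompatHull_chosen_of_star_envelope T.D M archPk archSub Ψ act Mmod region frobAdm frobLogvol frobΨ
    frobMmod unitImage ballImage thetaDiv n lat sig split qData qK pp ⟨i₀, hlt⟩ x₀ P hP a₀ hlo hhi ?_
  rw [hex]
  exact htest

/-! ## §3. Off `p ∣ e`: the different binder discharged (`δ = e − 1`) -/

/-- **RAD REFUTATION AT A RATIONAL POINT, classically tame local type (`p ∤ e`).** As
`GenuineK.not_pilotKummerCompatHull_chosen_ratPoint_of_star_envelope` with the different binder DISCHARGED: off `p ∣ e` the different exponent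
is `d(K_{x₀}) = (e−1)/e` (`differentOrd_eq_of_not_dvd`), so `δ := e − 1` and the only local input left at `x₀ | p` is the local type
`e(K_{x₀}/ℚ_p) = e` — the shape of every kind-RAD Frey row of HOME/plan/rescue/R-W/TARGETS.tsv at `p ≥ 7` (there `e ∣ 60·l`, `p ∤ 60·l`).
The certificate: `2l·e·N ≤ (i₀+1)²·h·e − 2l·((i₀+1)·(e−1) + (i₀+2)·A)` and `h·e < 2l·(e·N + (i₀+2)·(p^{a₀} − e·a₀))`.
[cite: SerreLocalFields1979, Ch. III §6 Prop. 13] [cite: Mochizuki2012, IUTchIII Cor. 3.12 Step (xi-f) p. 184] [claim: Mochizuki2012, status: disputed] -/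
theorem GenuineK.not_pilotKummerCompatHull_chosen_ratPoint_of_star_envelope_of_not_dvd {q : ℚ} {l : ℕ}
    (T : Cor22.ThetaVolumeDatumAt (ratPoint q) l) (pp : Nat.Primes) (hp2 : (pp : ℕ) ≠ 2) (hpl : (pp : ℕ) ≠ l)
    (h : ℕ) (hh : 1 ≤ h)
    (hord : ∀ u : HeightOneSpectrum (𝓞 ℚ), Rat.HeightOneSpectrum.natGenerator u = (pp : ℕ) → ord ℚ u (Cor22.jInv q) = -(h : ℤ))
    (i₀ : ℕ) (hil : i₀ + 1 ≤ (l - 1) / 2)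
    (e A a₀ : ℕ) (N : ℤ) (he : 1 ≤ e) (hpe : ¬ (pp : ℕ) ∣ e)
    (hAlo : (A - 1) * ((pp : ℕ) - 2) < e) (hAhi : e ≤ A * ((pp : ℕ) - 2))
    (ha₀lo : a₀ = 0 ∨ ((pp : ℕ) : ℤ) ^ (a₀ - 1) * (((pp : ℕ) : ℤ) - 1) < e)
    (ha₀hi : (e : ℤ) ≤ ((pp : ℕ) : ℤ) ^ a₀ * (((pp : ℕ) : ℤ) - 1))
    (hN1 : 2 * (l : ℤ) * e * N ≤ ((i₀ : ℤ) + 1) ^ 2 * h * e - 2 * l * (((i₀ : ℤ) + 1) * ((e : ℤ) - 1) + ((i₀ : ℤ) + 2) * A))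
    (hN2 : (h : ℤ) * e < 2 * l * ((e : ℤ) * N + ((i₀ : ℤ) + 2) * (((pp : ℕ) : ℤ) ^ a₀ - e * a₀))) :
    letI := T.instFieldF; letI := T.instNumberFieldF; letI := T.instAlgebraF; letI := T.instFieldK
    letI := T.instNumberFieldK; letI := T.instAlgebraK; letI := T.instFieldFbar; letI := T.instAlgebraFbar
    letI := T.instAlgebraKFbar; letI := T.instIsElliptic
    haveI : Fact (pp : ℕ).Prime := ⟨pp.2⟩
    ∀ (x₀ : (thetaIndex (pilotDataOfK T.D T.K)).Fibre (.inr pp)),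
      absRamificationIdx (pp : ℕ) (kOf (pilotDataOfK T.D T.K) pp.1 x₀) = e →
    ∀ (M : Type) [Field M] [NumberField M]
      (archPk : ∀ (j : (thetaIndex (pilotDataOfK T.D T.K)).Label) (vQ : (thetaIndex (pilotDataOfK T.D T.K)).VQ),
        Set ((logShellsDH (pilotDataOfK T.D T.K) (analyticLogv T.K)).Packet j vQ))
      (archSub : ∀ (j : (thetaIndex (pilotDataOfK T.D T.K)).Label) (v : (thetaIndex (pilotDataOfK T.D T.K)).V),
        Set ((logShellsDH (pilotDataOfK T.D T.K) (analyticLogv T.K)).Packet j ((thetaIndex (pilotDataOfK T.D T.K)).over v)))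
      (Ψ : ℤ → ∀ v : (thetaIndex (pilotDataOfK T.D T.K)).V, v ∈ (thetaIndex (pilotDataOfK T.D T.K)).Vbad →
        Set ((logShellsDH (pilotDataOfK T.D T.K) (analyticLogv T.K)).StarPacket v))
      (act : ℤ → ∀ v : (thetaIndex (pilotDataOfK T.D T.K)).V, v ∈ (thetaIndex (pilotDataOfK T.D T.K)).Vbad →
        (logShellsDH (pilotDataOfK T.D T.K) (analyticLogv T.K)).StarPacket v →
          Module.End ℚ ((logShellsDH (pilotDataOfK T.D T.K) (analyticLogv T.K)).StarPacket v))
      (Mmod : ℤ → ∀ j : (thetaIndex (pilotDataOfK T.D T.K)).LabelStar, Set ((logShellsDH (pilotDataOfK T.D T.K) (analyticLogv T.K)).GlobalPacket j.1))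
      (region : ℤ → ∀ j : (thetaIndex (pilotDataOfK T.D T.K)).LabelStar, FinDivisor M → ∀ vQ : (thetaIndex (pilotDataOfK T.D T.K)).VQ,
        Set ((logShellsDH (pilotDataOfK T.D T.K) (analyticLogv T.K)).Packet j.1 vQ))
      (frobAdm : ℤ → ℤ → ∀ (j : (thetaIndex (pilotDataOfK T.D T.K)).Label) (vQ : (thetaIndex (pilotDataOfK T.D T.K)).VQ),
        Set ((logShellsDH (pilotDataOfK T.D T.K) (analyticLogv T.K)).Packet j vQ) → Prop)
      (frobLogvol : ℤ → ℤ → ∀ (j : (thetaIndex (pilotDataOfK T.D T.K)).Label) (vQ : (thetaIndex (pilotDataOfK T.D T.K)).VQ),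
        Set ((logShellsDH (pilotDataOfK T.D T.K) (analyticLogv T.K)).Packet j vQ) → ℝ)
      (frobΨ : ℤ → ℤ → ∀ v : (thetaIndex (pilotDataOfK T.D T.K)).V, v ∈ (thetaIndex (pilotDataOfK T.D T.K)).Vbad →
        Set ((logShellsDH (pilotDataOfK T.D T.K) (analyticLogv T.K)).StarPacket v))
      (frobMmod : ℤ → ℤ → ∀ j : (thetaIndex (pilotDataOfK T.D T.K)).LabelStar, Set ((logShellsDH (pilotDataOfK T.D T.K) (analyticLogv T.K)).GlobalPacket j.1))
      (unitImage : ℤ → ℤ → ℕ → ∀ (j : (thetaIndex (pilotDataOfK T.D T.K)).Label) (vQ : (thetaIndex (pilotDataOfK T.D T.K)).VQ),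
        Set ((logShellsDH (pilotDataOfK T.D T.K) (analyticLogv T.K)).Packet j vQ))
      (ballImage : ℤ → ℤ → ∀ (j : (thetaIndex (pilotDataOfK T.D T.K)).Label) (vQ : (thetaIndex (pilotDataOfK T.D T.K)).VQ),
        Set ((logShellsDH (pilotDataOfK T.D T.K) (analyticLogv T.K)).Packet j vQ))
      (thetaDiv : ℤ → ℤ → LgpDivisor M (thetaIndex (pilotDataOfK T.D T.K)).lstar)
      (n : ℤ) {HT : Type} {LogLink : HT → HT → Type} {IsFull : ∀ {s t : HT}, LogLink s t → Prop}
      (lat : LGPGaussianLogThetaLattice LogLink IsFull)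
      {Frd : Type} {IsoF : Frd → Frd → Type} {Ob : Frd → Type} {realify : Frd → Frd} {Strip : Type}
      {IsoS : Strip → Strip → Type} {Mv : ∀ v : (thetaIndex (pilotDataOfK T.D T.K)).V, v ∈ (thetaIndex (pilotDataOfK T.D T.K)).Vbad → Type}
      [∀ v h, Monoid (Mv v h)]
      (sig : GlobalLGPFrobenioidSignature (thetaIndex (pilotDataOfK T.D T.K)).lstar (thetaIndex (pilotDataOfK T.D T.K)).V
        (· ∈ (thetaIndex (pilotDataOfK T.D T.K)).Vbad) Frd IsoF Ob realify Strip IsoS Mv)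
      (split : SplittingMonoids Mv) {ObΔ : Type} {N' : ∀ v : (thetaIndex (pilotDataOfK T.D T.K)).V, v ∈ (thetaIndex (pilotDataOfK T.D T.K)).Vbad → Type}
      [∀ v h, Monoid (N' v h)] (qData : QPilotData ObΔ N')
      (qK : ∀ v : (thetaIndex (pilotDataOfK T.D T.K)).V, v ∈ (thetaIndex (pilotDataOfK T.D T.K)).Vbad →
        Set ((logShellsDH (pilotDataOfK T.D T.K) (analyticLogv T.K)).StarPacket v)),
      ¬ Cor312Vol.PilotKummerCompatHull
          (LatticeSituation.ofShells (logShellsDH (pilotDataOfK T.D T.K) (analyticLogv T.K)) M archPk archSub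
            (summandPiecesPr (pilotDataOfK T.D T.K) (logvAnalytic_analyticLogv (F := T.K))).Adm
            (summandPiecesPr (pilotDataOfK T.D T.K) (logvAnalytic_analyticLogv (F := T.K))).logvol Ψ act Mmod region frobAdm frobLogvol frobΨ
            frobMmod unitImage ballImage thetaDiv)
          (settingPrVolSharp (pilotDataOfK T.D T.K) (logvAnalytic_analyticLogv (F := T.K)) M archPk archSub Ψ act Mmod region n lat sig split qData
            (exists_realising_qIdeles_pilotDataOfK T.D).choose (exists_realising_thetaIdeles_pilotDataOfK T.D).choose
            (exists_realising_qIdeles_pilotDataOfK T.D).choose_spec.1 (exists_realising_qIdeles_pilotDataOfK T.D).choose_spec.2.1)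
          (fun _ => Cor312.Setting.qRegion
            (settingPrVolSharp (pilotDataOfK T.D T.K) (logvAnalytic_analyticLogv (F := T.K)) M archPk archSub Ψ act Mmod region n lat sig split qData
              (exists_realising_qIdeles_pilotDataOfK T.D).choose (exists_realising_thetaIdeles_pilotDataOfK T.D).choose
              (exists_realising_qIdeles_pilotDataOfK T.D).choose_spec.1 (exists_realising_qIdeles_pilotDataOfK T.D).choose_spec.2.1)) qK := by
  classical
  letI := T.instFieldF; letI := T.instNumberFieldF; letI := T.instAlgebraF; letI := T.instFieldK
  letI := T.instNumberFieldK; letI := T.instAlgebraK; letI := T.instFieldFbar; letI := T.instAlgebraFbar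
  letI := T.instAlgebraKFbar; letI := T.instIsElliptic
  haveI : Fact (pp : ℕ).Prime := ⟨pp.2⟩
  intro x₀ hex
  have hδ : (e : ℝ) * differentOrd (pp : ℕ) (kOf (pilotDataOfK T.D T.K) pp.1 x₀) ≤ ((e - 1 : ℕ) : ℝ) := by
    have hnd : ¬ (pp : ℕ) ∣ absRamificationIdx (pp : ℕ) (kOf (pilotDataOfK T.D T.K) pp.1 x₀) := by rwa [hex]
    rw [differentOrd_eq_of_not_dvd (pp : ℕ) (kOf (pilotDataOfK T.D T.K) pp.1 x₀) hnd, hex, Nat.cast_sub he, Nat.cast_one]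
    have he0 : (e : ℝ) ≠ 0 := by exact_mod_cast (show e ≠ 0 by omega)
    rw [mul_div_cancel₀ _ he0]
  have hN1' : 2 * (l : ℤ) * e * N ≤ ((i₀ : ℤ) + 1) ^ 2 * h * e - 2 * l * (((i₀ : ℤ) + 1) * ((e - 1 : ℕ) : ℤ) + ((i₀ : ℤ) + 2) * A) := by
    rw [Nat.cast_sub he, Nat.cast_one]
    exact hN1
  exact GenuineK.not_pilotKummerCompatHull_chosen_ratPoint_of_star_envelope T pp hp2 hpl h hh hord i₀ hil e (e - 1) A a₀ N he hAlo hAhi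
    ha₀lo ha₀hi hN1' hN2 x₀ hex hδ

end Summit.ABC.IUTFork.Conditional

end
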